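import Mathlib
import Summits.CriticalPhenomena.CardyFormulaZ2.Theorems.CardySelfRefinementDefs
import Summits.CriticalPhenomena.CardyFormulaZ2.Theorems.CardySelfRefinementRussoDriftPolynomial
import Summits.CriticalPhenomena.CardyFormulaZ2.Theorems.CardySelfRefinementGradientComparabilityStubDcEqSumPivotal
import Summits.CriticalPhenomena.CardyFormulaZ2.Theorems.CardySelfRefinementTrivialSectorRateStubRussoOrbit
import Literature.Probability.Percolation.PivotalCell
import HarnessLib

/-!
# Influence-to-pivotality dictionary for line `far-field-is-a-quarter-turn` (crux `TrivialSectorRate`,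
stmt-CriticalPhenomena-10266), helper of stub `stub_pivotalMass`

The absolute orbit mass `Piv u` of a block is built from absolute coin influences `|infl i|`.  This
file bounds them by the `M_k`-probabilities of PIVOTALITY events of the bond configuration:

* `abs_infl_le_one` — `|infl i| ≤ 1`;
* `mem_cfg_iff_of_agree_off` — switching the coin `i` changes only the read-outs of the edges reading
  `i` (`edgeOf '' {vd | i ∈ coinsOf k vd}`), hence (`isPivotalOn_cfg_of_not_iff`) a coin flip that
  changes the outcome makes that edge set pivotal (`IsPivotalOn`) for `Aloc`;
* `abs_infl_le_real_isPivotalOn` — **`|infl i| ≤ M_k(q){the edges reading i are set-pivotal for Aloc}`**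
  for EVERY coin (no measurability needed: outer-measure monotonicity and `Measure.le_map_apply`);
* `infl_own_eq_real_isPivotal` — for the own coin of a NON-axial edge this is an equality with the
  probability that the edge is pivotal (`real_insert_sub_sdiff_own`), in particular `infl ≥ 0`;
* `setOf_selector_mem_coinsOf` / `setOf_shared_mem_coinsOf` / `setOf_own_mem_coinsOf` — the edges
  reading a selector or shared coin `(t,d,·)` are the fine edges `(v,d)` of coarse base `t`
  (the bundle and the parallel interior edges of the cell), those reading an own coin the edge itself;
* `edgeOf_mem_boxEdgesAt_of_tb` — every fine edge whose coarse base is one of the four cells at `u`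
  lies in the lattice box of radius `k` about the block centre `k•u`; hence
  (`abs_infl_selector_le_real_Rel`, `abs_infl_interior_le_real_Rel`) every coin entering `Piv u` has
  `|infl| ≤ M_k(q)(Rel u k)` and **`Piv u ≤ (2 + 2k²) · M_k(q)(Rel k m F η u k)`** (`Piv_le_real_Rel`,
  the registered helper): the absolute orbit mass of a block is at most a constant times the
  probability that the block's `k`-box is relevant (set-pivotal) for the localised crossing event.
-/

noncomputable section

namespace Summit.CriticalPhenomena.CardyFormulaZ2.Theorems.CardySelfRefinement.FarField

open scoped Topology
open Filter Set MeasureTheory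
open Literature.Probability.LatticeModels Literature.Probability.Percolation
open Literature.Probability.Percolation.QuadCrossing
open Summit.CriticalPhenomena.CardyFormulaZ2.Theses.CardySelfRefinement

/-! ## Influences are differences of probabilities -/

/-- `|infl i| ≤ 1`: an influence is a difference of two probabilities. -/
theorem abs_infl_le_one (k m : ℕ) (F : Fin m → Quad (univ : Set ℂ)) (η : ℝ) (q : ℝ × ℝ) (i : Coin) :
    |infl k m F η q i| ≤ 1 := by
  unfold infl
  have h1 : (coinLaw k q).real {S | insert i S ∈ coinEvent k m F η} ≤ 1 := measureReal_le_one
  have h2 : (coinLaw k q).real {S | S \ {i} ∈ coinEvent k m F η} ≤ 1 := measureReal_le_one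
  have h3 : 0 ≤ (coinLaw k q).real {S | insert i S ∈ coinEvent k m F η} := measureReal_nonneg
  have h4 : 0 ≤ (coinLaw k q).real {S | S \ {i} ∈ coinEvent k m F η} := measureReal_nonneg
  rw [abs_le]
  constructor <;> linarith

/-! ## Switching one coin only moves the edges reading it -/

/-- Coin sets agreeing off the coin `i` give the same read-out of every edge not reading `i`. -/
theorem mem_cfg_iff_of_agree_off (k : ℕ) {S S' : Set Coin} {i : Coin}
    (h : ∀ j, j ≠ i → (j ∈ S ↔ j ∈ S')) {e : Sym2 (Site 2)}
    (he : e ∉ edgeOf '' {vd | i ∈ coinsOf k vd}) : e ∈ cfg k S ↔ e ∈ cfg k S' := by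
  have key : ∀ (v : Site 2) (d : Fin 2), e = edgeOf (v, d) → (opn k S (v, d) ↔ opn k S' (v, d)) := by
    intro v d hed
    refine opn_congr k (v, d) fun j hj => h j ?_
    rintro rfl
    exact he ⟨(v, d), hj, hed.symm⟩
  constructor
  · rintro ⟨v, d, hed, hopn⟩
    exact ⟨v, d, hed, (key v d hed).1 hopn⟩
  · rintro ⟨v, d, hed, hopn⟩
    exact ⟨v, d, hed, (key v d hed).2 hopn⟩

/-- If switching the coin `i` changes the outcome of the pulled-back localised crossing event at `S`,
then the set of edges reading `i` is pivotal (as a set) for `Aloc` in the configuration `cfg k S`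
(one of `insert i S`, `S \ {i}` is `S` itself, the other reads out to a configuration agreeing with
`cfg k S` off that edge set). -/
theorem isPivotalOn_cfg_of_not_iff (k m : ℕ) (F : Fin m → Quad (univ : Set ℂ)) (η : ℝ) {S : Set Coin}
    {i : Coin} (h : ¬ (insert i S ∈ coinEvent k m F η ↔ S \ {i} ∈ coinEvent k m F η)) :
    IsPivotalOn (Aloc m F η) (edgeOf '' {vd | i ∈ coinsOf k vd}) (cfg k S) := by
  by_cases hiS : i ∈ S
  · have hins : insert i S = S := Set.insert_eq_of_mem hiS
    rw [hins] at h
    refine ⟨cfg k (S \ {i}), fun e he => ?_, fun hiff => h hiff.symm⟩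
    refine mem_cfg_iff_of_agree_off k (fun j hj => ?_) he
    simp only [Set.mem_sdiff, Set.mem_singleton_iff, hj, not_false_eq_true, and_true]
  · have hsd : S \ {i} = S := by
      ext j
      simp only [Set.mem_sdiff, Set.mem_singleton_iff, and_iff_left_iff_imp]
      rintro hj rfl
      exact hiS hj
    rw [hsd] at h
    refine ⟨cfg k (insert i S), fun e he => ?_, fun hiff => h hiff⟩
    refine mem_cfg_iff_of_agree_off k (fun j hj => ?_) he
    simp only [Set.mem_insert_iff, hj, false_or]

/-- **Influence ≤ set-pivotality.**  For every coin `i`, `|infl i|` is at most the `M_k(q)`-probability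
that the set of edges reading `i` is pivotal for the localised joint crossing event. -/
theorem abs_infl_le_real_isPivotalOn (k m : ℕ) (F : Fin m → Quad (univ : Set ℂ)) (η : ℝ) (q : ℝ × ℝ)
    (i : Coin) :
    |infl k m F η q i| ≤
      (M k q.1 q.2).real {ω | IsPivotalOn (Aloc m F η) (edgeOf '' {vd | i ∈ coinsOf k vd}) ω} := by
  haveI := isProbabilityMeasure_M k q.1 q.2
  set P : Set (BondConfig (Site 2)) :=
    {ω | IsPivotalOn (Aloc m F η) (edgeOf '' {vd | i ∈ coinsOf k vd}) ω} with hP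
  set A : Set (Set Coin) := {S | insert i S ∈ coinEvent k m F η} with hA
  set B : Set (Set Coin) := {S | S \ {i} ∈ coinEvent k m F η} with hB
  have hAB : A \ B ⊆ cfg k ⁻¹' P := fun S hS =>
    isPivotalOn_cfg_of_not_iff k m F η fun hiff => hS.2 (hiff.1 hS.1)
  have hBA : B \ A ⊆ cfg k ⁻¹' P := fun S hS =>
    isPivotalOn_cfg_of_not_iff k m F η fun hiff => hS.2 (hiff.2 hS.1)
  have hpre : (coinLaw k q).real (cfg k ⁻¹' P) ≤ (M k q.1 q.2).real P := by
    show (coinLaw k q).real _ ≤ ((coinLaw k q).map (cfg k)).real P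
    simp only [Measure.real]
    exact ENNReal.toReal_mono (measure_ne_top _ _)
      (Measure.le_map_apply (measurable_cfg k).aemeasurable P)
  have h1 : (coinLaw k q).real A ≤ (coinLaw k q).real B + (coinLaw k q).real (A \ B) :=
    calc (coinLaw k q).real A ≤ (coinLaw k q).real (A \ B ∪ B) :=
          measureReal_mono (Set.subset_sdiff_union A B)
      _ ≤ (coinLaw k q).real (A \ B) + (coinLaw k q).real B := measureReal_union_le _ _
      _ = _ := add_comm _ _
  have h2 : (coinLaw k q).real B ≤ (coinLaw k q).real A + (coinLaw k q).real (B \ A) :=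
    calc (coinLaw k q).real B ≤ (coinLaw k q).real (B \ A ∪ A) :=
          measureReal_mono (Set.subset_sdiff_union B A)
      _ ≤ (coinLaw k q).real (B \ A) + (coinLaw k q).real A := measureReal_union_le _ _
      _ = _ := add_comm _ _
  have h3 : (coinLaw k q).real (A \ B) ≤ (M k q.1 q.2).real P := (measureReal_mono hAB).trans hpre
  have h4 : (coinLaw k q).real (B \ A) ≤ (M k q.1 q.2).real P := (measureReal_mono hBA).trans hpre
  have hinfl : infl k m F η q i = (coinLaw k q).real A - (coinLaw k q).real B := rfl
  rw [hinfl, abs_le]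
  constructor <;> linarith

/-! ## Own coins of non-axial edges: influence = probability of pivotality -/

/-- For the own coin of a NON-axial edge the influence IS the `M_k(q)`-probability that the edge is
pivotal for `Aloc` (`real_insert_sub_sdiff_own`). -/
theorem infl_own_eq_real_isPivotal (k m : ℕ) (F : Fin m → Quad (univ : Set ℂ)) {η : ℝ} (hη : η ≠ 0)
    (q : ℝ × ℝ) {v : Site 2} {d : Fin 2} (hax : ¬ ax k (v, d)) :
    infl k m F η q (v, d, (0 : Fin 3)) =
      (M k q.1 q.2).real {ω | IsPivotal (Aloc m F η) (edgeOf (v, d)) ω} := by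
  unfold infl
  exact real_insert_sub_sdiff_own k m F hη q.1 q.2 hax

/-- Hence the influence of the own coin of a non-axial edge is nonnegative. -/
theorem infl_own_nonneg (k m : ℕ) (F : Fin m → Quad (univ : Set ℂ)) {η : ℝ} (hη : η ≠ 0)
    (q : ℝ × ℝ) {v : Site 2} {d : Fin 2} (hax : ¬ ax k (v, d)) :
    0 ≤ infl k m F η q (v, d, (0 : Fin 3)) := by
  rw [infl_own_eq_real_isPivotal k m F hη q hax]
  exact measureReal_nonneg

/-- And its absolute value is that probability. -/
theorem abs_infl_own_eq_real_isPivotal (k m : ℕ) (F : Fin m → Quad (univ : Set ℂ)) {η : ℝ} (hη : η ≠ 0)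
    (q : ℝ × ℝ) {v : Site 2} {d : Fin 2} (hax : ¬ ax k (v, d)) :
    |infl k m F η q (v, d, (0 : Fin 3))| =
      (M k q.1 q.2).real {ω | IsPivotal (Aloc m F η) (edgeOf (v, d)) ω} := by
  rw [abs_of_nonneg (infl_own_nonneg k m F hη q hax), infl_own_eq_real_isPivotal k m F hη q hax]

/-! ## The edges reading a given coin -/

/-- The edges reading the own coin `(v,d,0)`: the edge `(v,d)` only. -/
theorem setOf_own_mem_coinsOf (k : ℕ) (v : Site 2) (d : Fin 2) :
    {vd : Site 2 × Fin 2 | ((v, d, (0 : Fin 3)) : Coin) ∈ coinsOf k vd} = {(v, d)} := by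
  ext vd
  rw [Set.mem_setOf_eq, Set.mem_singleton_iff]
  exact own_mem_coinsOf_iff k vd v d

/-- The edges reading the selector coin `(t,d,2)`: the fine edges of direction `d` and coarse base
`t` (the bundle `(t,d)` and the parallel interior edges of the cell `t`). -/
theorem setOf_selector_mem_coinsOf (k : ℕ) (t : Site 2) (d : Fin 2) :
    {vd : Site 2 × Fin 2 | ((t, d, (2 : Fin 3)) : Coin) ∈ coinsOf k vd} = {vd | tb k vd = t ∧ vd.2 = d} := by
  ext ⟨v, d'⟩
  simp only [coinsOf, Set.mem_setOf_eq, Set.mem_insert_iff, Set.mem_singleton_iff, Prod.mk.injEq]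
  constructor
  · rintro (⟨-, -, h⟩ | ⟨-, -, h⟩ | ⟨h1, h2, -⟩)
    · exact absurd h (by decide)
    · exact absurd h (by decide)
    · exact ⟨h1.symm, h2.symm⟩
  · rintro ⟨h1, h2⟩
    exact Or.inr (Or.inr ⟨h1.symm, h2.symm, trivial⟩)

/-- The edges reading the shared coin `(t,d,1)`: the same set. -/
theorem setOf_shared_mem_coinsOf (k : ℕ) (t : Site 2) (d : Fin 2) :
    {vd : Site 2 × Fin 2 | ((t, d, (1 : Fin 3)) : Coin) ∈ coinsOf k vd} = {vd | tb k vd = t ∧ vd.2 = d} := by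
  ext ⟨v, d'⟩
  simp only [coinsOf, Set.mem_setOf_eq, Set.mem_insert_iff, Set.mem_singleton_iff, Prod.mk.injEq]
  constructor
  · rintro (⟨-, -, h⟩ | ⟨h1, h2, -⟩ | ⟨-, -, h⟩)
    · exact absurd h (by decide)
    · exact ⟨h1.symm, h2.symm⟩
    · exact absurd h (by decide)
  · rintro ⟨h1, h2⟩
    exact Or.inr (Or.inl ⟨h1.symm, h2.symm, trivial⟩)

/-! ## Every coin entering `Piv u` is read inside the `k`-box about `k•u` -/

/-- A cell at `u` has base `t` with `u i − 1 ≤ t i ≤ u i`. -/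
theorem sub_one_le_of_mem_cellsAt {u t : Site 2} (ht : t ∈ cellsAt u) (i : Fin 2) :
    u i - 1 ≤ t i ∧ t i ≤ u i := by
  simp only [cellsAt, Finset.mem_insert, Finset.mem_singleton] at ht
  rcases ht with rfl | rfl | rfl | rfl <;> fin_cases i <;> simp

/-- The coarse base of a bundle at `u` is a cell at `u`. -/
theorem fst_mem_cellsAt_of_mem_bundlesAt {u : Site 2} {b : Site 2 × Fin 2} (hb : b ∈ bundlesAt u) :
    b.1 ∈ cellsAt u := by
  simp only [bundlesAt, Finset.mem_insert, Finset.mem_singleton] at hb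
  simp only [cellsAt, Finset.mem_insert, Finset.mem_singleton]
  rcases hb with rfl | rfl | rfl | rfl
  · exact Or.inl rfl
  · exact Or.inl rfl
  · exact Or.inr (Or.inl rfl)
  · exact Or.inr (Or.inr (Or.inl rfl))

/-- `dirVec d i ≤ 1`. -/
theorem dirVec_apply_le_one (d i : Fin 2) : dirVec d i ≤ 1 := by
  fin_cases d <;> fin_cases i <;> simp [dirVec]

/-- **A fine edge whose coarse base is one of the four cells at `u` lies in the lattice box of radius
`k` about the block centre `k•u`** (both endpoints within sup-distance `k`). -/
theorem edgeOf_mem_boxEdgesAt_of_tb {k : ℕ} (hk : 0 < k) {u : Site 2} {vd : Site 2 × Fin 2}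
    (ht : tb k vd ∈ cellsAt u) : edgeOf vd ∈ boxEdgesAt (ctr k u) k := by
  obtain ⟨v, d⟩ := vd
  refine ⟨?_, fun w hw => ?_⟩
  · rw [SimpleGraph.mem_edgeSet]
    exact (zdGraph_adj_iff _ _).2 ⟨d, Or.inl (by simp only [dirVec]; rw [dirVec_eq_single])⟩
  · rw [mem_box]
    intro i
    have hk0 : (0 : ℤ) < k := by exact_mod_cast hk
    obtain ⟨htlo, hthi⟩ := sub_one_le_of_mem_cellsAt ht i
    have htb : tb k (v, d) i = v i / k := rfl
    rw [htb] at htlo hthi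
    have h1 : v i / k * k ≤ v i := Int.ediv_mul_le _ hk0.ne'
    have h2 : v i < (v i / k + 1) * k := Int.lt_ediv_add_one_mul_self _ hk0
    have hlo : (u i - 1) * (k : ℤ) ≤ v i := le_trans (Int.mul_le_mul_of_nonneg_right htlo hk0.le) h1
    have hhi : v i < (u i + 1) * (k : ℤ) :=
      lt_of_lt_of_le h2 (Int.mul_le_mul_of_nonneg_right (by linarith) hk0.le)
    have hw' : w i = v i ∨ w i = v i + dirVec d i := by
      rcases Sym2.mem_iff.1 hw with rfl | rfl
      · exact Or.inl rfl
      · exact Or.inr rfl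
    have hd0 := dirVec_apply_nonneg d i
    have hd1 := dirVec_apply_le_one d i
    have hwlo : v i ≤ w i := by rcases hw' with h | h <;> linarith
    have hwhi : w i ≤ v i + 1 := by rcases hw' with h | h <;> linarith
    have hctr : (w - ctr k u) i = w i - k * u i := rfl
    rw [hctr]
    constructor <;> nlinarith

/-- The set of edges reading the selector coin of a bundle at `u` lies in the `k`-box about `k•u`. -/
theorem image_selector_subset_boxEdgesAt {k : ℕ} (hk : 0 < k) {u : Site 2} {b : Site 2 × Fin 2}
    (hb : b ∈ bundlesAt u) :
    edgeOf '' {vd : Site 2 × Fin 2 | ((b.1, b.2, (2 : Fin 3)) : Coin) ∈ coinsOf k vd} ⊆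
      boxEdgesAt (ctr k u) k := by
  rw [setOf_selector_mem_coinsOf]
  rintro _ ⟨vd, ⟨htb, -⟩, rfl⟩
  exact edgeOf_mem_boxEdgesAt_of_tb hk (htb ▸ fst_mem_cellsAt_of_mem_bundlesAt hb)

/-- The edge of an interior edge of a cell at `u` lies in the `k`-box about `k•u`. -/
theorem edgeOf_mem_boxEdgesAt_of_mem_interiorEdges {k : ℕ} (hk : 0 < k) {u t : Site 2}
    (ht : t ∈ cellsAt u) {e : Site 2 × Fin 2} (he : e ∈ interiorEdges k t) :
    edgeOf e ∈ boxEdgesAt (ctr k u) k :=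
  edgeOf_mem_boxEdgesAt_of_tb hk ((tb_eq_of_mem_interiorEdges hk he).symm ▸ ht)

/-- `Rel` is monotone in the radius. -/
theorem Rel_mono (k m : ℕ) (F : Fin m → Quad (univ : Set ℂ)) (η : ℝ) (u : Site 2) {R R' : ℕ}
    (h : R ≤ R') : Rel k m F η u R ⊆ Rel k m F η u R' := fun _ hω =>
  IsPivotalOn.mono hω fun _ he => ⟨he.1, fun v hv => box_mono 2 h (he.2 v hv)⟩

/-- **Selector coins of the block**: `|infl (selector of b)| ≤ M_k(q)(Rel u k)` for `b ∈ bundlesAt u`. -/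
theorem abs_infl_selector_le_real_Rel {k : ℕ} (hk : 0 < k) (m : ℕ) (F : Fin m → Quad (univ : Set ℂ))
    (η : ℝ) (q : ℝ × ℝ) {u : Site 2} {b : Site 2 × Fin 2} (hb : b ∈ bundlesAt u) :
    |infl k m F η q (b.1, b.2, (2 : Fin 3))| ≤ (M k q.1 q.2).real (Rel k m F η u k) := by
  haveI := isProbabilityMeasure_M k q.1 q.2
  refine (abs_infl_le_real_isPivotalOn k m F η q _).trans (measureReal_mono fun ω hω => ?_)
  exact IsPivotalOn.mono hω (image_selector_subset_boxEdgesAt hk hb)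

/-- **Interior coins of the block**: `|infl (own coin of e)| ≤ M_k(q)(Rel u k)` for an interior edge `e`
of a cell at `u`. -/
theorem abs_infl_interior_le_real_Rel {k : ℕ} (hk : 0 < k) (m : ℕ) (F : Fin m → Quad (univ : Set ℂ))
    (η : ℝ) (q : ℝ × ℝ) {u t : Site 2} (ht : t ∈ cellsAt u) {e : Site 2 × Fin 2}
    (he : e ∈ interiorEdges k t) :
    |infl k m F η q (e.1, e.2, (0 : Fin 3))| ≤ (M k q.1 q.2).real (Rel k m F η u k) := by
  haveI := isProbabilityMeasure_M k q.1 q.2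
  refine (abs_infl_le_real_isPivotalOn k m F η q _).trans (measureReal_mono fun ω hω => ?_)
  refine IsPivotalOn.mono hω ?_
  rw [setOf_own_mem_coinsOf, Set.image_singleton, Set.singleton_subset_iff]
  exact edgeOf_mem_boxEdgesAt_of_mem_interiorEdges hk ht he

/-- A cell has at most `2k²` interior edges. -/
theorem card_interiorEdges_le (k : ℕ) (t : Site 2) : (interiorEdges k t).card ≤ 2 * k ^ 2 := by
  classical
  unfold interiorEdges
  refine (Finset.card_filter_le _ _).trans (Finset.card_image_le.trans ?_)
  simp [Finset.card_univ, Fintype.card_prod, Fintype.card_fin]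
  nlinarith

/-- `bundlesAt u` has at most four elements. -/
theorem card_bundlesAt_le (u : Site 2) : (bundlesAt u).card ≤ 4 := by
  unfold bundlesAt
  refine (Finset.card_insert_le _ _).trans ?_
  refine (Nat.succ_le_succ (Finset.card_insert_le _ _)).trans ?_
  refine (Nat.succ_le_succ (Nat.succ_le_succ (Finset.card_insert_le _ _))).trans ?_
  simp

/-- `cellsAt u` has at most four elements. -/
theorem card_cellsAt_le (u : Site 2) : (cellsAt u).card ≤ 4 := by
  unfold cellsAt
  refine (Finset.card_insert_le _ _).trans ?_
  refine (Nat.succ_le_succ (Finset.card_insert_le _ _)).trans ?_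
  refine (Nat.succ_le_succ (Nat.succ_le_succ (Finset.card_insert_le _ _))).trans ?_
  simp

/-- **BLOCK MASS ≤ BLOCK RELEVANCE** (registered helper of `stub_pivotalMass`).  The absolute orbit
mass of the block of `u` is at most `(2 + 2k²)` times the `M_k(q)`-probability that the lattice box
of radius `k` about `k•u` is relevant (set-pivotal) for the localised joint crossing event: every one
of the `≤ 4` selector coins and `≤ 4 · 2k²` interior coins of the block is read inside that box, and
`|infl i| ≤ M_k(q)(edges reading i set-pivotal)`. -/
theorem Piv_le_real_Rel (k m : ℕ) (hk : 0 < k) (F : Fin m → Quad (univ : Set ℂ)) (η : ℝ) (q : ℝ × ℝ)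
    (u : Site 2) : Piv k m F η q u ≤ (2 + 2 * (k : ℝ) ^ 2) * (M k q.1 q.2).real (Rel k m F η u k) := by
  set ρ : ℝ := (M k q.1 q.2).real (Rel k m F η u k) with hρ
  have hρ0 : 0 ≤ ρ := measureReal_nonneg
  have h1 : ∑ b ∈ bundlesAt u, |infl k m F η q (b.1, b.2, (2 : Fin 3))| ≤ 4 * ρ := by
    calc ∑ b ∈ bundlesAt u, |infl k m F η q (b.1, b.2, (2 : Fin 3))|
        ≤ ∑ b ∈ bundlesAt u, ρ := Finset.sum_le_sum fun b hb => abs_infl_selector_le_real_Rel hk m F η q hb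
      _ = (bundlesAt u).card * ρ := by rw [Finset.sum_const, nsmul_eq_mul]
      _ ≤ 4 * ρ := by
          gcongr
          exact_mod_cast card_bundlesAt_le u
  have h2 : ∑ t ∈ cellsAt u, ∑ e ∈ interiorEdges k t, |infl k m F η q (e.1, e.2, (0 : Fin 3))| ≤
      4 * (2 * (k : ℝ) ^ 2 * ρ) := by
    calc ∑ t ∈ cellsAt u, ∑ e ∈ interiorEdges k t, |infl k m F η q (e.1, e.2, (0 : Fin 3))|
        ≤ ∑ t ∈ cellsAt u, 2 * (k : ℝ) ^ 2 * ρ := by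
          refine Finset.sum_le_sum fun t ht => ?_
          calc ∑ e ∈ interiorEdges k t, |infl k m F η q (e.1, e.2, (0 : Fin 3))|
              ≤ ∑ e ∈ interiorEdges k t, ρ :=
                Finset.sum_le_sum fun e he => abs_infl_interior_le_real_Rel hk m F η q ht he
            _ = (interiorEdges k t).card * ρ := by rw [Finset.sum_const, nsmul_eq_mul]
            _ ≤ 2 * (k : ℝ) ^ 2 * ρ := by
                gcongr
                exact_mod_cast card_interiorEdges_le k t
      _ = (cellsAt u).card * (2 * (k : ℝ) ^ 2 * ρ) := by rw [Finset.sum_const, nsmul_eq_mul]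
      _ ≤ 4 * (2 * (k : ℝ) ^ 2 * ρ) := by
          gcongr
          exact_mod_cast card_cellsAt_le u
  unfold Piv
  nlinarith

/-- The layer-weighted orbit mass of any finite set of blocks is at most `(2 + 2k²)` times the
layer-weighted block relevance (`η > 0`, `r > 0`). -/
theorem sum_wt_mul_Piv_le (k m : ℕ) (hk : 0 < k) (F : Fin m → Quad (univ : Set ℂ)) {η r : ℝ}
    (hη : 0 < η) (hr : 0 < r) (q : ℝ × ℝ) (U : Finset (Site 2)) :
    ∑ u ∈ U, wt k m F η r u * Piv k m F η q u ≤
      (2 + 2 * (k : ℝ) ^ 2) * ∑ u ∈ U, wt k m F η r u * (M k q.1 q.2).real (Rel k m F η u k) := by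
  rw [Finset.mul_sum]
  refine Finset.sum_le_sum fun u _ => ?_
  have hwt : 0 ≤ wt k m F η r u := by
    unfold wt
    have : 0 < max (bdist k m F η u) (r * η) := lt_max_of_lt_right (by positivity)
    positivity
  calc wt k m F η r u * Piv k m F η q u
      ≤ wt k m F η r u * ((2 + 2 * (k : ℝ) ^ 2) * (M k q.1 q.2).real (Rel k m F η u k)) :=
        mul_le_mul_of_nonneg_left (Piv_le_real_Rel k m hk F η q u) hwt
    _ = (2 + 2 * (k : ℝ) ^ 2) * (wt k m F η r u * (M k q.1 q.2).real (Rel k m F η u k)) := by ring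

end Summit.CriticalPhenomena.CardyFormulaZ2.Theorems.CardySelfRefinement.FarField

end
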